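import Summits.QuantumFields.GaugeBoot.Certificates.SparseReducedWindow
import Summits.QuantumFields.GaugeBoot.Certificates.KZL2rpD4b2427o1000UpDA
import Summits.QuantumFields.GaugeBoot.Certificates.KZL2rpD4b2427o1000UpDB
import Summits.QuantumFields.GaugeBoot.Certificates.KZL2rpD4b2427o1000UpDC
import HarnessLib

/-!
# Kernel replay of the certsdp certificate `kzL2_D4_b2427o1000_max_rp_G2` — part G: factor-row assembly and objective (gb_lean_emit_win 0.10)

HONEST FRAMING (cell `pub-gaugeboot`): certified bounds on lattice expectations at stated coupling,
gauge group, dimension and torus size; NOT a mass gap, NOT a continuum limit, NOT a string tension;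
NOT Yang–Mills-summit-bearing (barriers `FixedCouplingUltralocality`, `PerturbativeInvisibility`).

Certificate sha256 `988f10b0c074b12811fe88faa00d9b1f6a1e576bad0b0eaad8144c352367d00e` (problem `kzL2_D4_b2427o1000_max_rp_G2`, sha256 `3e4be5fc425ba31f0bcf1dd35032f4718b8564e94a72d7dfaaed35bf6cc68b9a`): `GB` = all factor rows (data parts
`Certificates/KZL2rpD4b2427o1000UpD….lean` concatenated), the INTEGER objective row `cZ`, the certified bound `lowerQ`, and the kernel check
`gb_len` (factor rows fit the padded dimension 48). Windows: `Certificates/KZL2rpD4b2427o1000UpA….lean`; assembly + theorems: `Certificates/KZL2rpD4b2427o1000Up.lean`.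
Data/plumbing only; nothing is claimed about lattice gauge theory in this file.
-/

namespace Summit.QuantumFields.GaugeBoot.Certificates.KZL2rpD4b2427o1000Up

noncomputable section

open Summit.QuantumFields.GaugeBoot.Certificates.Sparse

/-- All factor rows (concatenation of the data parts' block lists). -/
def GB : List (List (List ℤ)) := GBa ++ GBb ++ GBc

/-- Objective as a sparse INTEGER row: (-1)·y_1. -/
def cZ : List (ℕ × ℤ) := [(1, Int.negSucc 0)]

/-- The certified lower bound on the objective (exact): `-1089015690909329201613786218033960685566081062024602812807/1563817758485645595356465229209109354176839680000000000000` (≈ -0.6963827370549). -/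
def lowerQ : ℚ := -1089015690909329201613786218033960685566081062024602812807/1563817758485645595356465229209109354176839680000000000000

set_option maxHeartbeats 0 in
/-- Kernel check: every factor row of every block has length `≤ 48`. -/
theorem gb_len : lenCheckAll KZL2rpD4b2427o1000Up.GB 48 70 = true := by
  decide +kernel

end

end Summit.QuantumFields.GaugeBoot.Certificates.KZL2rpD4b2427o1000Up
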